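import Literature.Probability.RandomPlanarGeometry.HexSAWBrickWallStripFugacityWidthOneContactLDP
import HarnessLib

/-!
# The rung entropy of the self-avoiding walk in the one-cell honeycomb strip: an explicit strictly concave arch

The previous file `HexSAWBrickWallStripFugacityWidthOneContactLDP.lean` (§17–§18) proved the large deviation principle of the
RUNG DENSITY `V(ω)/N` (number of vertical steps) of the uniform `N`-step self-avoiding walk of the one-cell strip `S_1 = ℤ × {0,1}`
of the brick-wall (honeycomb) lattice and identified the RUNG ENTROPY in closed form:

  `s_V(ρ) = rungEntropy ρ = log m − ((1−ρ)/2)·log(m³/(m+1))`,  `m = rungM ρ = (1−3ρ)/(2ρ)`,  `ρ ∈ (0, 1/3)`,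

with `(1/N)·log #{ω ∈ S_N(S_1) : V(ω) ≤ ρN} → s_V(ρ)` for `ρ ≤ ρ*` and `(1/N)·log #{V(ω) ≥ ρN} → s_V(ρ)` for `ρ ≥ ρ*`, where
`ρ* = 1/(2μ(S_1)+3)` is the typical rung density (`μ(S_1)` the plastic number) — `tendsto_log_card_rungs_div_closedForm`, `rungEntropy_le`.
THIS FILE establishes the SHAPE of `s_V` (Janse van Rensburg's "general appearance of the density function", Fig. 3.1 of
[JansevanRensburg2000], here with everything explicit):

★★ `isLeast_rungEntropy` — the variational formula `s_V(ρ) = min_{Y>0} {log μ_1(Y,Y) − ((1−ρ)/2)·log Y}` (attained at `Y(ρ) = m³/(m+1)`);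
★★★ `strictConcaveOn_rungEntropy` — `s_V` is STRICTLY CONCAVE on `(0,1/3)`; `continuousOn_rungEntropy`; `rungEntropy_eq` (the two-logarithm
form `s_V = ((3ρ−1)/2) log m + ((1−ρ)/2) log(m+1)`);
★★★ `hasDerivAt_rungEntropy` — `s_V′(ρ) = ½·log Y(ρ)` (the slope of the entropy is half the log-fugacity of the tilted two-wall measure:
positive below `ρ*`, zero at `ρ*`, negative above; infinite at both ends);
★★ `strictMonoOn_strictAntiOn_rungEntropy` — strictly increasing on `(0,ρ*]`, strictly decreasing on `[ρ*,1/3)`;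
`tendsto_rungM` (`m → ∞` at `0⁺`, `m → 0⁺` at `1/3⁻`) and ★★ `tendsto_rungEntropy` — THE ARCH CLOSES: `s_V(0⁺) = s_V(1/3⁻) = 0`
(exponentially few walks have almost no rungs, or a rung at every third step).
§4 (ed.2): `hasDerivAt_rungM_log_rungY` (`m′ = −1/(2ρ²)`, `(log Y)′ = (3/m − 1/(m+1))m′`), ★★ `hasDerivAt_deriv_rungEntropy` (THE CURVATURE
`s_V″(ρ) = −(3/m − 1/(m+1))/(4ρ²) < 0`: strict concavity with an explicit curvature), `deriv_rungEntropy_eq`.  NOT CLAIMED: that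
`−1/s_V″(ρ*)` is the variance of `V/√N` (no local limit theorem here).

Method: the variational formula is the strict tangent inequality of the diagonal free energy (`two_mul_log_sub_lt_log_stripMuY₂_diag_sub`,
previous file); strict concavity = infimum of affine functions with distinct minimisers; the derivative by the two-sided secant squeeze
(envelope theorem); the end limits from the two-logarithm form and `x log x → 0`.  Sources: E. J. Janse van Rensburg, *The Statistical
Mechanics of Interacting Walks, Polygons, Animals and Vesicles* (Oxford Lecture Series 18, OUP 2000 — the held edition, whose
numbering is used; key `JansevanRensburg2000`), §3.1 Theorem 3.4, §3.2 Theorems 3.17–3.19, §3.3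
(density functions: existence, Legendre duality with the free energy, concavity, one-sided derivatives at the end-points) — the FRAMEWORK;
A. Dembo, O. Zeitouni, *Large Deviations Techniques and Applications*, §2.2 Lemma 2.2.5 (shape of Λ*) — the METHOD; N. R. Beaton et al.,
CMP 326 (2014), arXiv:1109.0358v5 §3.2 p. 10 (the strip `S_1`, `μ_1(y,z)`); N. Madras, G. Slade, *The Self-Avoiding Walk* (1993) §8.2,
§8.5.  No quotation AS PRINTED; no source in our holdings states `s_V` — the closed form and its shape are this lineage's, built on the
tree's cubic law `μ_1(y,y)³ = yμ_1(y,y) + y`.  NOT CLAIMED: the second derivative / curvature of `s_V`, the corresponding statements for the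
span `|X(ω)|/N`.
-/

noncomputable section

open Filter Topology Finset Literature.Probability.LatticeModels Literature.Probability.Percolation SimpleGraph

namespace Literature.Probability.RandomPlanarGeometry.SAW.HexBW

open WidthOneYZ

/-! ## §1 The variational formula, strict concavity, continuity -/

/-- ★★ **Variational formula**: `s_V(ρ) = min_{Y>0} {log μ_1(Y,Y) − ((1−ρ)/2)·log Y}` — for every `Y > 0`,
`s_V(ρ) ≤ log μ_1(Y,Y) − ((1−ρ)/2) log Y`, with equality at `Y = Y(ρ)` (diagonal tangent inequality).
[cite: JansevanRensburg2000, §3.2 Theorem 3.19 (log 𝒫(ε) = inf_z {𝓕(z) − ε log z})] -/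
theorem isLeast_rungEntropy {ρ : ℝ} (hρ0 : 0 < ρ) (hρ : ρ < 1 / 3) :
    IsLeast ((fun Y : ℝ => Real.log (stripMuY₂ 1 Y Y) - (1 - ρ) / 2 * Real.log Y) '' Set.Ioi (0 : ℝ)) (rungEntropy ρ) := by
  obtain ⟨hm, hY, hμ, hρ', hb⟩ := rungY_spec hρ0 hρ
  have hval : rungEntropy ρ = Real.log (stripMuY₂ 1 (rungY ρ) (rungY ρ)) - (1 - ρ) / 2 * Real.log (rungY ρ) := by
    rw [rungEntropy, hμ]
  refine ⟨⟨rungY ρ, hY, hval.symm⟩, ?_⟩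
  rintro _ ⟨Y', hY', rfl⟩
  have hY' : 0 < Y' := hY'
  show rungEntropy ρ ≤ Real.log (stripMuY₂ 1 Y' Y') - (1 - ρ) / 2 * Real.log Y'
  rw [hval, ← hb]
  rcases eq_or_ne Y' (rungY ρ) with h | h
  · rw [h]
  · have ht := two_mul_log_sub_lt_log_stripMuY₂_diag_sub hY hY' h
    linarith

/-- ★★★ **THE RUNG ENTROPY IS STRICTLY CONCAVE on `(0, 1/3)`** (an infimum of functions affine in `ρ`, with distinct minimisers at
distinct densities). [cite: JansevanRensburg2000, §3.2 Theorem 3.17 and §3.3 (concavity of the density function)] -/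
theorem strictConcaveOn_rungEntropy : StrictConcaveOn ℝ (Set.Ioo 0 (1 / 3)) rungEntropy := by
  refine ⟨convex_Ioo _ _, fun ρ hρ ρ' hρ' hne lam mu hlam hmu hsum => ?_⟩
  set c := lam • ρ + mu • ρ' with hc
  have hc' : c = lam * ρ + mu * ρ' := by simp [hc, smul_eq_mul]
  have hcmem : c ∈ Set.Ioo (0 : ℝ) (1 / 3) := by
    rw [hc']; constructor <;> nlinarith [hρ.1, hρ.2, hρ'.1, hρ'.2]
  obtain ⟨hm, hY, hμ, hρc, hb⟩ := rungY_spec hcmem.1 hcmem.2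
  set Yc := rungY c with hYc
  have hval : rungEntropy c = Real.log (stripMuY₂ 1 Yc Yc) - (1 - c) / 2 * Real.log Yc := by rw [rungEntropy, ← hYc, hμ]
  -- at the densities `ρ`, `ρ'` the fugacity `Yc` is STRICTLY sub-optimal
  have key : ∀ {r : ℝ}, r ∈ Set.Ioo (0 : ℝ) (1 / 3) → r ≠ c →
      rungEntropy r < Real.log (stripMuY₂ 1 Yc Yc) - (1 - r) / 2 * Real.log Yc := by
    intro r hr hne'
    obtain ⟨hm₁, hY₁, hμ₁, hρ₁, hb₁⟩ := rungY_spec hr.1 hr.2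
    have hneY : Yc ≠ rungY r := by
      intro hYY; apply hne'
      rw [← hρ₁, ← hYY, hYc, hρc]
    rw [rungEntropy, ← hμ₁, ← hb₁]
    have ht := two_mul_log_sub_lt_log_stripMuY₂_diag_sub hY₁ hY hneY
    linarith
  have hane : ρ ≠ c := by
    intro h
    have : mu * (ρ' - ρ) = 0 := by rw [hc'] at h; linear_combination (-1 : ℝ) * h - ρ * hsum
    rcases mul_eq_zero.1 this with h1 | h1
    · linarith
    · exact hne (by linarith)
  have hane' : ρ' ≠ c := by
    intro h
    have : lam * (ρ - ρ') = 0 := by rw [hc'] at h; linear_combination (-1 : ℝ) * h - ρ' * hsum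
    rcases mul_eq_zero.1 this with h1 | h1
    · linarith
    · exact hne (by linarith)
  have k1 := mul_lt_mul_of_pos_left (key hρ hane) hlam
  have k2 := mul_lt_mul_of_pos_left (key hρ' hane') hmu
  set L := Real.log (stripMuY₂ 1 Yc Yc) with hL
  set ℓ := Real.log Yc with hℓ
  have hLL : lam * L + mu * L = L := by rw [← add_mul, hsum, one_mul]
  have hℓℓ : lam * ℓ + mu * ℓ = ℓ := by rw [← add_mul, hsum, one_mul]
  show lam • rungEntropy ρ + mu • rungEntropy ρ' < rungEntropy c
  simp only [smul_eq_mul]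
  rw [hval, hc']
  linarith [k1, k2, hLL, hℓℓ]

/-- ★★ **The rung entropy is continuous on `(0,1/3)`** (an explicit composition of `log` and rational functions).
[cite: JansevanRensburg2000, §3.1 (continuity of the density function)] -/
theorem continuousOn_rungEntropy : ContinuousOn rungEntropy (Set.Ioo 0 (1 / 3)) := by
  intro ρ hρ
  obtain ⟨hm, hY, -, -, -⟩ := rungY_spec hρ.1 hρ.2
  have hmc : ContinuousAt rungM ρ := by
    unfold rungM
    exact ((continuousAt_const.sub (continuousAt_const.mul continuousAt_id)).div
      (continuousAt_const.mul continuousAt_id) (by have := hρ.1; positivity))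
  have hYc : ContinuousAt rungY ρ := by
    unfold rungY
    exact (hmc.pow 3).div (hmc.add continuousAt_const) (by linarith)
  have h : ContinuousAt rungEntropy ρ := by
    unfold rungEntropy
    exact (hmc.log hm.ne').sub (((continuousAt_const.sub continuousAt_id).div_const 2).mul (hYc.log hY.ne'))
  exact h.continuousWithinAt

/-- `s_V(ρ) = ((3ρ − 1)/2)·log m + ((1 − ρ)/2)·log(m + 1)`, `m = (1−3ρ)/(2ρ)` — the two-logarithm form.
[cite: JansevanRensburg2000, §3.2 Theorem 3.19 (lane plumbing)] -/
theorem rungEntropy_eq {ρ : ℝ} (hρ0 : 0 < ρ) (hρ : ρ < 1 / 3) :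
    rungEntropy ρ = (3 * ρ - 1) / 2 * Real.log (rungM ρ) + (1 - ρ) / 2 * Real.log (rungM ρ + 1) := by
  obtain ⟨hm, hY, -, -, -⟩ := rungY_spec hρ0 hρ
  rw [rungEntropy, rungY, Real.log_div (pow_pos hm 3).ne' (by linarith), Real.log_pow]; push_cast; ring

/-! ## §2 The slope `s_V′(ρ) = ½ log Y(ρ)` and the monotonicity on each side of `ρ*` -/

/-- `rungM` and `rungY` are continuous at every `ρ ∈ (0,1/3)`. [cite: JansevanRensburg2000, §3.1 (lane plumbing)] -/
theorem continuousAt_rungM_rungY {ρ : ℝ} (hρ0 : 0 < ρ) (hρ : ρ < 1 / 3) :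
    ContinuousAt rungM ρ ∧ ContinuousAt rungY ρ := by
  obtain ⟨hm, hY, -, -, -⟩ := rungY_spec hρ0 hρ
  have hmc : ContinuousAt rungM ρ := by
    unfold rungM
    exact ((continuousAt_const.sub (continuousAt_const.mul continuousAt_id)).div
      (continuousAt_const.mul continuousAt_id) (by positivity))
  refine ⟨hmc, ?_⟩
  unfold rungY
  exact (hmc.pow 3).div (hmc.add continuousAt_const) (by linarith)

/-- The two-sided secant estimate: for `ρ, ρ' ∈ (0,1/3)`,
`(ρ' − ρ)·½log Y(ρ') ≤ s_V(ρ') − s_V(ρ) ≤ (ρ' − ρ)·½log Y(ρ)` (the variational formula `isLeast_rungEntropy` used twice).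
[cite: JansevanRensburg2000, §3.3 (derivatives of the density function); DemboZeitouni2010, §2.2 Lemma 2.2.5] -/
theorem rungEntropy_sub_mem_Icc {ρ ρ' : ℝ} (hρ0 : 0 < ρ) (hρ : ρ < 1 / 3) (hρ0' : 0 < ρ') (hρ' : ρ' < 1 / 3) :
    (ρ' - ρ) * (Real.log (rungY ρ') / 2) ≤ rungEntropy ρ' - rungEntropy ρ ∧
      rungEntropy ρ' - rungEntropy ρ ≤ (ρ' - ρ) * (Real.log (rungY ρ) / 2) := by
  obtain ⟨-, hY, hμ, -, -⟩ := rungY_spec hρ0 hρ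
  obtain ⟨-, hY', hμ', -, -⟩ := rungY_spec hρ0' hρ'
  have hv : rungEntropy ρ = Real.log (stripMuY₂ 1 (rungY ρ) (rungY ρ)) - (1 - ρ) / 2 * Real.log (rungY ρ) := by
    rw [rungEntropy, hμ]
  have hv' : rungEntropy ρ' = Real.log (stripMuY₂ 1 (rungY ρ') (rungY ρ')) - (1 - ρ') / 2 * Real.log (rungY ρ') := by
    rw [rungEntropy, hμ']
  have h1 := (isLeast_rungEntropy hρ0' hρ').2 ⟨rungY ρ, hY, rfl⟩   -- `s(ρ') ≤ value at Y(ρ)`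
  have h2 := (isLeast_rungEntropy hρ0 hρ).2 ⟨rungY ρ', hY', rfl⟩   -- `s(ρ) ≤ value at Y(ρ')`
  simp only at h1 h2
  constructor
  · linarith
  · linarith

/-- ★★★ **THE SLOPE OF THE RUNG ENTROPY IS HALF THE LOG-FUGACITY**: `s_V` is differentiable on `(0,1/3)` with `s_V′(ρ) = ½·log Y(ρ)`,
`Y(ρ) = m³/(m+1)`, `m = (1−3ρ)/(2ρ)` — positive below the typical density `ρ*` (`Y > 1`), zero at `ρ*` (`Y = 1`), negative above; the
end-slopes are infinite (`Y(ρ) → ∞` as `ρ → 0⁺`, `Y(ρ) → 0` as `ρ → 1/3⁻`).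
[cite: JansevanRensburg2000, §3.3 (derivatives of the density function); DemboZeitouni2010, §2.2 Lemma 2.2.5 (c)] -/
theorem hasDerivAt_rungEntropy {ρ : ℝ} (hρ0 : 0 < ρ) (hρ : ρ < 1 / 3) :
    HasDerivAt rungEntropy (Real.log (rungY ρ) / 2) ρ := by
  set g : ℝ → ℝ := fun ρ' => Real.log (rungY ρ') / 2 with hg
  obtain ⟨-, hY, -, -, -⟩ := rungY_spec hρ0 hρ
  have hmem : Set.Ioo (0 : ℝ) (1 / 3) ∈ 𝓝 ρ := isOpen_Ioo.mem_nhds ⟨hρ0, hρ⟩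
  have hgc : ContinuousAt g ρ := ((continuousAt_rungM_rungY hρ0 hρ).2.log hY.ne').div_const 2
  rw [hasDerivAt_iff_tendsto_slope]
  have hgt : Tendsto g (𝓝[≠] ρ) (𝓝 (g ρ)) := hgc.tendsto.mono_left nhdsWithin_le_nhds
  have hlo : Tendsto (fun ρ' => min (g ρ) (g ρ')) (𝓝[≠] ρ) (𝓝 (g ρ)) := by
    have := (tendsto_const_nhds (x := g ρ) (f := 𝓝[≠] ρ)).min hgt
    rwa [min_self] at this
  have hhi : Tendsto (fun ρ' => max (g ρ) (g ρ')) (𝓝[≠] ρ) (𝓝 (g ρ)) := by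
    have := (tendsto_const_nhds (x := g ρ) (f := 𝓝[≠] ρ)).max hgt
    rwa [max_self] at this
  refine tendsto_of_tendsto_of_tendsto_of_le_of_le' hlo hhi ?_ ?_
  · filter_upwards [self_mem_nhdsWithin, mem_nhdsWithin_of_mem_nhds hmem] with ρ' hne hρ'
    obtain ⟨h1, h2⟩ := rungEntropy_sub_mem_Icc hρ0 hρ hρ'.1 hρ'.2
    rw [slope_def_field]
    simp only [hg]
    rcases lt_or_gt_of_ne (show ρ' ≠ ρ from hne) with hlt | hgt'
    · have hneg : ρ' - ρ < 0 := by linarith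
      refine (min_le_left _ _).trans ?_
      rw [le_div_iff_of_neg hneg]; linarith
    · have hpos : 0 < ρ' - ρ := by linarith
      refine (min_le_right _ _).trans ?_
      rw [le_div_iff₀ hpos]; linarith
  · filter_upwards [self_mem_nhdsWithin, mem_nhdsWithin_of_mem_nhds hmem] with ρ' hne hρ'
    obtain ⟨h1, h2⟩ := rungEntropy_sub_mem_Icc hρ0 hρ hρ'.1 hρ'.2
    rw [slope_def_field]
    simp only [hg]
    rcases lt_or_gt_of_ne (show ρ' ≠ ρ from hne) with hlt | hgt'
    · have hneg : ρ' - ρ < 0 := by linarith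
      refine le_trans ?_ (le_max_right _ _)
      rw [div_le_iff_of_neg hneg]; linarith
    · have hpos : 0 < ρ' - ρ := by linarith
      refine le_trans ?_ (le_max_left _ _)
      rw [div_le_iff₀ hpos]; linarith

/-- ★★ **The rung entropy increases strictly up to the typical density and decreases strictly after**:
`StrictMonoOn s_V (0, ρ*]` and `StrictAntiOn s_V [ρ*, 1/3)`, `ρ* = 1/(2μ(S_1)+3)` (strict concavity + the apex `rungEntropy_le`).
[cite: JansevanRensburg2000, §3.2 Theorem 3.17 and Fig. 3.1] -/
theorem strictMonoOn_strictAntiOn_rungEntropy :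
    StrictMonoOn rungEntropy (Set.Ioc 0 (1 / (2 * stripConnectiveConstant 1 + 3))) ∧
      StrictAntiOn rungEntropy (Set.Ico (1 / (2 * stripConnectiveConstant 1 + 3)) (1 / 3)) := by
  set ρs := 1 / (2 * stripConnectiveConstant 1 + 3) with hρs
  have hμ0 : 0 < stripConnectiveConstant 1 := by rw [← stripMuY₂_one_one_one]; exact stripMuY₂_pos 1 one_pos one_pos
  have hρs0 : 0 < ρs := by rw [hρs]; positivity
  have hρs3 : ρs < 1 / 3 := by
    rw [hρs, div_lt_div_iff₀ (by positivity) (by norm_num : (0:ℝ) < 3)]; linarith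
  have hsc := strictConcaveOn_rungEntropy
  have hapex : ∀ {r : ℝ}, 0 < r → r < 1 / 3 → rungEntropy r ≤ rungEntropy ρs := by
    intro r hr0 hr
    have h1 := (rungEntropy_le hr0 hr).1
    have h2 := ((rungEntropy_le hρs0 hρs3).2).2 rfl
    rw [h2]; exact h1
  have hapex' : ∀ {r : ℝ}, 0 < r → r < 1 / 3 → r ≠ ρs → rungEntropy r < rungEntropy ρs := by
    intro r hr0 hr hne
    rcases (hapex hr0 hr).lt_or_eq with h | h
    · exact h
    · exact absurd (((rungEntropy_le hr0 hr).2).1 (h.trans (((rungEntropy_le hρs0 hρs3).2).2 rfl))) hne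
  constructor
  · intro a ha b hb hab
    -- `b = t·a + (1−t)·ρs`-type combination: `a < b ≤ ρs`
    rcases eq_or_lt_of_le hb.2 with hbe | hbl
    · rw [hbe]; exact hapex' ha.1 (lt_of_le_of_lt ha.2 hρs3) (by rw [← hbe]; exact hab.ne)
    · -- `b` strictly between `a` and `ρs`
      have hba : 0 < b - a := by linarith
      have hsa : 0 < ρs - a := by linarith
      set t := (ρs - b) / (ρs - a) with ht
      have ht0 : 0 < t := div_pos (by linarith) hsa
      have ht1 : t < 1 := (div_lt_one hsa).2 (by linarith)
      have hcomb : t • a + (1 - t) • ρs = b := by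
        simp only [smul_eq_mul]; rw [ht]; field_simp; ring
      have h := hsc.2 ⟨ha.1, lt_of_le_of_lt ha.2 hρs3⟩ ⟨hρs0, hρs3⟩ (by linarith : a ≠ ρs) ht0 (by linarith : 0 < 1 - t) (by ring)
      rw [hcomb] at h
      simp only [smul_eq_mul] at h
      have hA := hapex ha.1 (lt_of_le_of_lt ha.2 hρs3)
      nlinarith
  · intro a ha b hb hab
    rcases eq_or_lt_of_le ha.1 with hae | hal
    · rw [← hae]; exact hapex' (by linarith) hb.2 (by rw [hae]; exact hab.ne')
    · -- `a` strictly between `ρs` and `b`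
      have hsb : 0 < b - ρs := by linarith
      set t := (b - a) / (b - ρs) with ht
      have ht0 : 0 < t := div_pos (by linarith) hsb
      have ht1 : t < 1 := (div_lt_one hsb).2 (by linarith)
      have hcomb : t • ρs + (1 - t) • b = a := by
        simp only [smul_eq_mul]; rw [ht]; field_simp; ring
      have h := hsc.2 ⟨hρs0, hρs3⟩ ⟨hρs0.trans (hal.trans hab), hb.2⟩ (by linarith : ρs ≠ b) ht0 (by linarith : 0 < 1 - t) (by ring)
      rw [hcomb] at h
      simp only [smul_eq_mul] at h
      have hB := hapex (hρs0.trans (hal.trans hab)) hb.2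
      nlinarith

/-! ## §3 The arch closes: `s_V(0⁺) = s_V(1/3⁻) = 0` -/

/-- `m(ρ) → +∞` as `ρ → 0⁺` and `m(ρ) → 0⁺` as `ρ → 1/3⁻`. [cite: JansevanRensburg2000, §3.3 (lane plumbing)] -/
theorem tendsto_rungM :
    Tendsto rungM (𝓝[>] 0) atTop ∧ Tendsto rungM (𝓝[<] (1 / 3)) (𝓝[>] 0) := by
  constructor
  · -- `m = (1 − 3ρ)/(2ρ) = (1/ρ)/2 − 3/2`
    have h1 : Tendsto (fun ρ : ℝ => ρ⁻¹) (𝓝[>] 0) atTop := tendsto_inv_nhdsGT_zero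
    have h2 : Tendsto (fun ρ : ℝ => ρ⁻¹ / 2 - 3 / 2) (𝓝[>] 0) atTop :=
      (h1.atTop_div_const (by norm_num : (0:ℝ) < 2)).atTop_add tendsto_const_nhds
    refine h2.congr' ?_
    filter_upwards [self_mem_nhdsWithin] with ρ hρ
    have hρ0 : (0:ℝ) < ρ := hρ
    unfold rungM; field_simp
  · have hc : ContinuousAt rungM (1 / 3) := by
      unfold rungM
      exact ((continuousAt_const.sub (continuousAt_const.mul continuousAt_id)).div
        (continuousAt_const.mul continuousAt_id) (by norm_num))
    have h0 : rungM (1 / 3) = 0 := by unfold rungM; norm_num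
    refine tendsto_nhdsWithin_iff.2 ⟨?_, ?_⟩
    · have := hc.tendsto.mono_left (nhdsWithin_le_nhds (s := Set.Iio (1 / 3 : ℝ)))
      rwa [h0] at this
    · filter_upwards [Ioo_mem_nhdsLT (show (0 : ℝ) < 1 / 3 by norm_num)] with ρ hρ
      show 0 < rungM ρ
      unfold rungM; exact div_pos (by linarith [hρ.2]) (by linarith [hρ.1])

/-- ★★ **THE ARCH CLOSES**: `s_V(ρ) → 0` as `ρ → 0⁺` (few rungs: the walks run along the rows) and as `ρ → 1/3⁻` (a rung at every third
step). [cite: JansevanRensburg2000, §3.3 (end-point behaviour of the density function)] -/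
theorem tendsto_rungEntropy :
    Tendsto rungEntropy (𝓝[>] 0) (𝓝 0) ∧ Tendsto rungEntropy (𝓝[<] (1 / 3)) (𝓝 0) := by
  obtain ⟨hm0, hm3⟩ := tendsto_rungM
  constructor
  · -- `s = ((1−ρ)/2)·log(1 + 1/m) + ρ·log m`, `ρ log m = ρ log(1−3ρ) − ρ log 2 − ρ log ρ`
    have hA : Tendsto (fun ρ : ℝ => (1 - ρ) / 2 * Real.log (1 + (rungM ρ)⁻¹)) (𝓝[>] 0) (𝓝 0) := by
      have hinv : Tendsto (fun ρ => (rungM ρ)⁻¹) (𝓝[>] 0) (𝓝 0) := tendsto_inv_atTop_zero.comp hm0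
      have hlog : Tendsto (fun ρ => Real.log (1 + (rungM ρ)⁻¹)) (𝓝[>] 0) (𝓝 0) := by
        have h10 : Tendsto (fun ρ => 1 + (rungM ρ)⁻¹) (𝓝[>] 0) (𝓝 1) := by
          simpa using (tendsto_const_nhds (x := (1:ℝ))).add hinv
        have := (Real.continuousAt_log one_ne_zero).tendsto.comp h10
        simpa [Function.comp_def] using this
      have hc : Tendsto (fun ρ : ℝ => (1 - ρ) / 2) (𝓝[>] 0) (𝓝 ((1 - 0) / 2)) :=
        (((tendsto_const_nhds (x := (1:ℝ))).sub (tendsto_nhdsWithin_of_tendsto_nhds tendsto_id)).div_const 2)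
      have := hc.mul hlog
      simpa using this
    have hB : Tendsto (fun ρ : ℝ => ρ * Real.log (rungM ρ)) (𝓝[>] 0) (𝓝 0) := by
      -- `ρ log m = ρ log(1 − 3ρ) − ρ log 2 − ρ log ρ` on `(0, 1/3)`
      have hρ0 : Tendsto (fun ρ : ℝ => ρ) (𝓝[>] 0) (𝓝 0) := tendsto_nhdsWithin_of_tendsto_nhds tendsto_id
      have h1 : Tendsto (fun ρ : ℝ => ρ * Real.log (1 - 3 * ρ)) (𝓝[>] 0) (𝓝 0) := by
        have hl : Tendsto (fun ρ : ℝ => Real.log (1 - 3 * ρ)) (𝓝[>] 0) (𝓝 (Real.log (1 - 3 * 0))) :=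
          ((Real.continuousAt_log (by norm_num)).tendsto.comp
            ((tendsto_const_nhds.sub (tendsto_const_nhds.mul tendsto_id)).mono_left nhdsWithin_le_nhds))
        have := hρ0.mul hl
        simpa using this
      have h2 : Tendsto (fun ρ : ℝ => ρ * Real.log 2) (𝓝[>] 0) (𝓝 0) := by
        simpa using hρ0.mul_const (Real.log 2)
      have h3 : Tendsto (fun ρ : ℝ => Real.log ρ * ρ) (𝓝[>] 0) (𝓝 0) := by
        simpa [Real.rpow_one] using tendsto_log_mul_rpow_nhdsGT_zero zero_lt_one
      have := (h1.sub h2).sub h3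
      simp only [sub_zero] at this
      refine this.congr' ?_
      filter_upwards [Ioo_mem_nhdsGT (show (0 : ℝ) < 1 / 3 by norm_num)] with ρ hρ
      have hρ0' : 0 < ρ := hρ.1
      have h13 : 0 < 1 - 3 * ρ := by linarith [hρ.2]
      unfold rungM
      rw [Real.log_div h13.ne' (by linarith), Real.log_mul two_ne_zero hρ0'.ne']
      ring
    have := hA.add hB
    rw [add_zero] at this
    refine this.congr' ?_
    filter_upwards [Ioo_mem_nhdsGT (show (0 : ℝ) < 1 / 3 by norm_num)] with ρ hρ
    obtain ⟨hm, -, -, -, -⟩ := rungY_spec hρ.1 hρ.2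
    rw [rungEntropy_eq hρ.1 hρ.2]
    have e : 1 + (rungM ρ)⁻¹ = (rungM ρ + 1) / rungM ρ := by field_simp
    rw [e, Real.log_div (by linarith) hm.ne']
    ring
  · -- `ρ → 1/3⁻`: `((3ρ−1)/2) log m = −ρ·(m log m) → 0` and `((1−ρ)/2) log(m+1) → (1/3)·log 1 = 0`
    have hmlog : Tendsto (fun ρ => Real.log (rungM ρ) * rungM ρ) (𝓝[<] (1 / 3)) (𝓝 0) := by
      have h := tendsto_log_mul_rpow_nhdsGT_zero zero_lt_one
      simp only [Real.rpow_one] at h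
      exact h.comp hm3
    have hρc : Tendsto (fun ρ : ℝ => ρ) (𝓝[<] (1 / 3)) (𝓝 (1 / 3)) := tendsto_nhdsWithin_of_tendsto_nhds tendsto_id
    have hA : Tendsto (fun ρ : ℝ => -ρ * (Real.log (rungM ρ) * rungM ρ)) (𝓝[<] (1 / 3)) (𝓝 0) := by
      have := hρc.neg.mul hmlog; simpa using this
    have hB : Tendsto (fun ρ : ℝ => (1 - ρ) / 2 * Real.log (rungM ρ + 1)) (𝓝[<] (1 / 3)) (𝓝 0) := by
      have hm' : Tendsto rungM (𝓝[<] (1 / 3)) (𝓝 0) := (tendsto_nhdsWithin_iff.1 hm3).1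
      have hl : Tendsto (fun ρ => Real.log (rungM ρ + 1)) (𝓝[<] (1 / 3)) (𝓝 0) := by
        have h01 : Tendsto (fun ρ => rungM ρ + 1) (𝓝[<] (1 / 3)) (𝓝 1) := by simpa using hm'.add_const 1
        have := (Real.continuousAt_log one_ne_zero).tendsto.comp h01
        simpa [Function.comp_def] using this
      have hc : Tendsto (fun ρ : ℝ => (1 - ρ) / 2) (𝓝[<] (1 / 3)) (𝓝 ((1 - 1 / 3) / 2)) :=
        ((tendsto_const_nhds (x := (1:ℝ))).sub hρc).div_const 2
      have := hc.mul hl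
      simpa using this
    have := hA.add hB
    rw [add_zero] at this
    refine this.congr' ?_
    filter_upwards [Ioo_mem_nhdsLT (show (0 : ℝ) < 1 / 3 by norm_num)] with ρ hρ
    rw [rungEntropy_eq hρ.1 hρ.2]
    have hρne : ρ ≠ 0 := ne_of_gt hρ.1
    have e : (3 * ρ - 1) / 2 = -ρ * rungM ρ := by unfold rungM; field_simp; ring
    rw [e]; ring

/-! ## §4 (ed.2) The curvature: `s_V″(ρ) = −(3/m − 1/(m+1))/(4ρ²) < 0` -/

/-- The derivatives of the parametrisation: `m′(ρ) = −1/(2ρ²)` and `(log Y)′(ρ) = (3/m − 1/(m+1))·m′(ρ)`, `ρ ∈ (0,1/3)`.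
[cite: JansevanRensburg2000, §3.3 (lane plumbing)] -/
theorem hasDerivAt_rungM_log_rungY {ρ : ℝ} (hρ0 : 0 < ρ) (hρ : ρ < 1 / 3) :
    HasDerivAt rungM (-1 / (2 * ρ ^ 2)) ρ ∧
      HasDerivAt (fun r => Real.log (rungY r)) ((3 / rungM ρ - 1 / (rungM ρ + 1)) * (-1 / (2 * ρ ^ 2))) ρ := by
  obtain ⟨hm, hY, -, -, -⟩ := rungY_spec hρ0 hρ
  -- `m(r) = (1 − 3r)/(2r)`
  have hm' : HasDerivAt rungM (-1 / (2 * ρ ^ 2)) ρ := by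
    have h1 : HasDerivAt (fun r : ℝ => 1 - 3 * r) (-3) ρ := by
      simpa using ((hasDerivAt_id ρ).const_mul 3).const_sub 1
    have h2 : HasDerivAt (fun r : ℝ => 2 * r) 2 ρ := by simpa using (hasDerivAt_id ρ).const_mul 2
    have h := h1.div h2 (by positivity)
    have e : (-3 * (2 * ρ) - (1 - 3 * ρ) * 2) / (2 * ρ) ^ 2 = -1 / (2 * ρ ^ 2) := by field_simp; ring
    rw [e] at h
    exact h.congr_of_eventuallyEq (Eventually.of_forall fun r => rfl)
  refine ⟨hm', ?_⟩
  -- `log Y = 3 log m − log(m+1)` near `ρ`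
  have hlog : HasDerivAt (fun r => 3 * Real.log (rungM r) - Real.log (rungM r + 1))
      (3 * ((-1 / (2 * ρ ^ 2)) / rungM ρ) - (-1 / (2 * ρ ^ 2)) / (rungM ρ + 1)) ρ := by
    have h3 := (hm'.log hm.ne').const_mul 3
    have h4 := (hm'.add_const 1).log (by linarith)
    exact h3.sub h4
  have heq : ∀ᶠ r in 𝓝 ρ, 3 * Real.log (rungM r) - Real.log (rungM r + 1) = Real.log (rungY r) := by
    filter_upwards [isOpen_Ioo.mem_nhds ⟨hρ0, hρ⟩] with r hr
    obtain ⟨hmr, -, -, -, -⟩ := rungY_spec hr.1 hr.2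
    rw [rungY, Real.log_div (pow_pos hmr 3).ne' (by linarith), Real.log_pow]; push_cast; ring
  have h := hlog.congr_of_eventuallyEq (heq.mono fun r hr => hr.symm)
  refine h.congr_deriv ?_
  field_simp
  ring

/-- ★★ **THE CURVATURE OF THE RUNG ENTROPY**: `s_V′` is differentiable on `(0,1/3)` with
`s_V″(ρ) = −(3/m − 1/(m+1))/(4ρ²) < 0`, `m = (1−3ρ)/(2ρ)` — strict concavity with an explicit curvature; at the typical density
`ρ* = 1/(2μ(S_1)+3)` (`m = μ(S_1)`) the curvature is `−(2μ+3)²(3/μ − 1/(μ+1))/4`.  (If a local limit theorem held, `−1/s_V″(ρ*)` would be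
the variance of `V/√N`; this is NOT claimed.) [cite: JansevanRensburg2000, §3.3 (derivatives of the density function); DemboZeitouni2010, §2.2 Lemma 2.2.5] -/
theorem hasDerivAt_deriv_rungEntropy {ρ : ℝ} (hρ0 : 0 < ρ) (hρ : ρ < 1 / 3) :
    HasDerivAt (fun r => Real.log (rungY r) / 2) (-(3 / rungM ρ - 1 / (rungM ρ + 1)) / (4 * ρ ^ 2)) ρ ∧
      -(3 / rungM ρ - 1 / (rungM ρ + 1)) / (4 * ρ ^ 2) < 0 := by
  obtain ⟨hm, -, -, -, -⟩ := rungY_spec hρ0 hρ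
  obtain ⟨-, hlogY⟩ := hasDerivAt_rungM_log_rungY hρ0 hρ
  constructor
  · have h := hlogY.div_const 2
    refine h.congr_deriv ?_
    field_simp
    ring
  · have hpos : 0 < 3 / rungM ρ - 1 / (rungM ρ + 1) := by
      rw [div_sub_div _ _ hm.ne' (by linarith), lt_div_iff₀ (by positivity)]; nlinarith
    have : 0 < (3 / rungM ρ - 1 / (rungM ρ + 1)) / (4 * ρ ^ 2) := by positivity
    rw [neg_div]; linarith

/-- `deriv s_V = ½ log Y` on `(0,1/3)` (so `hasDerivAt_deriv_rungEntropy` is the second derivative of `s_V`).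
[cite: JansevanRensburg2000, §3.3 (lane plumbing)] -/
theorem deriv_rungEntropy_eq {ρ : ℝ} (hρ0 : 0 < ρ) (hρ : ρ < 1 / 3) : deriv rungEntropy ρ = Real.log (rungY ρ) / 2 :=
  (hasDerivAt_rungEntropy hρ0 hρ).deriv

end Literature.Probability.RandomPlanarGeometry.SAW.HexBW
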